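import Mathlib
import HarnessLib
import Summits.Ventures.LatticeQCDFlow.Exactness.SphereLuscherSeriesExistence

/-!
# Lüscher's flow-action series on the lattice of site spheres is unique up to additive constants at every order; for a polynomial action every series is polynomial

HONEST FRAMING: exact (Metropolis-corrected) sampling algorithms for lattice gauge theory;
figures of merit are autocorrelation/cost numbers at stated couplings and volumes; no
continuum-physics claim.

Venture `LatticeQCDFlow` (cell pub-lqcd), topic `Exactness`; FANOUT row 7 (`s0-cpn-null`).  NEW
WORK of the cell over Mathlib and the tree's `Exactness/SphereLatticeLuscherKernel.lean` (GEN-8: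
`luscher_poisson_unique` — two `C²` solutions of `−Σ_k ∂̃_k·∂̃_k X = R + c` have the same `c` and
differ by a constant on the product of spheres), `Exactness/SphereLatticeGreen.lean`
(`sphereConfig_update`, `sphereConfig_ne_zero`), `Exactness/SphereLOFlowAction.lean` (`siteGrad`,
`siteLaplacian`) and `Exactness/SphereLuscherSeriesExistence.lean` (existence, polynomial order by
order); nothing is cited as a fact.  Sphere-model counterpart of theory-1's gauge-side
`TrivializingMaps/SeriesUniqueness.lean`.  Printed counterpart, NAMED ONLY: M. Lüscher, Commun.
Math. Phys. 293 (2010) 899, §3.3 (the null space of `𝔏₀` is the constants, so each order of the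
flow action "is obtained recursively … uniquely up to a constant"), §4.3 eqs. (4.12)–(4.15);
Engel–Schaefer, Comput. Phys. Commun. 182 (2011) 2107, §3 eqs. (14)–(16).

## Content (`E` finite-dimensional real inner product space, `dim E ≥ 2`; `Λ` finite)

* **`siteGrad_eq_of_forall_eq_add_const`** — E–S's natural derivative `∂̃_k` ONLY SEES THE
  RESTRICTION TO THE SPHERES, UP TO CONSTANTS: if `F₁ = F₂ + c` on the product of unit spheres
  then `∂̃_k F₁ = ∂̃_k F₂` there (the site section `y ↦ F(ξ[k ← y/‖y‖])` stays on the spheres near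
  `ξ k`); hence the source `−Σ_n ⟪∂̃_n S, ∂̃_n X⟫` of the next order does not see the constant
  ambiguity of the previous one (`sum_inner_siteGrad_congr`).
* **`luscher_series_unique`** — LÜSCHER'S RECURSION `−Σ∂̃²S̃⁽⁰⁾ = S + ċ₀`,
  `−Σ∂̃²S̃⁽ᵏ⁺¹⁾ = −Σ⟪∂̃S, ∂̃S̃⁽ᵏ⁾⟩ + ċ_{k+1}` HAS, FOR ANY ACTION, AT MOST ONE `C²` SOLUTION UP TO
  ADDITIVE CONSTANTS ORDER BY ORDER, AND THE CONSTANTS `ċ_k` ARE UNIQUELY DETERMINED (induction on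
  `k` over `luscher_poisson_unique`).
* **`luscher_series_polynomial`** — combined with `exists_luscher_series`: for a lattice-polynomial
  action of degree `≤ a`, EVERY `C²` solution of the recursion is, at order `k`, a lattice polynomial
  of degree `≤ a(k+1)` plus a constant on the product of unit spheres, with the constants `ċ_k` of
  the polynomial series; `luscher_series_esAction_polynomial` — the Engel–Schaefer case (degree
  `2(k+1)`).

NOT CLAIMED: anything at `t > 0` or about convergence; locality of the terms; anything quantitative.
-/

noncomputable section

namespace Summit.Ventures.LatticeQCDFlow.Exactness

open Function Set NormedSpace InnerProductSpace Metric Filter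
open scoped RealInnerProductSpace ContDiff Gradient Topology

variable {Λ : Type*} {E : Type*} [NormedAddCommGroup E] [InnerProductSpace ℝ E]
variable [FiniteDimensional ℝ E] [Fintype Λ] [DecidableEq Λ]

/-! ## §1 The natural derivative only sees the restriction to the spheres, up to constants -/

section OnlySpheres

omit [Fintype Λ] in
/-- **`∂̃_k` only sees `F|_Ω` up to constants**: if `F₁ = F₂ + c` on the product of unit spheres,
then `∂̃_k F₁ = ∂̃_k F₂` there. -/
theorem siteGrad_eq_of_forall_eq_add_const {F₁ F₂ : (Λ → E) → ℝ} {c : ℝ}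
    (h : ∀ ξ : Λ → sphere (0 : E) 1, F₁ (fun n => (ξ n : E)) = F₂ (fun n => (ξ n : E)) + c)
    (ξ : Λ → sphere (0 : E) 1) (k : Λ) :
    siteGrad k F₁ (fun n => (ξ n : E)) = siteGrad k F₂ (fun n => (ξ n : E)) := by
  unfold siteGrad gradient
  congr 1
  have hx0 : (ξ k : E) ≠ 0 := sphereConfig_ne_zero ξ k
  have hev : (fun y : E => F₁ (update (fun n => (ξ n : E)) k (normalize y))) =ᶠ[𝓝 (ξ k : E)]
      fun y => F₂ (update (fun n => (ξ n : E)) k (normalize y)) + c := by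
    filter_upwards [isOpen_compl_singleton.mem_nhds hx0] with y hy
    have hy0 : y ≠ 0 := hy
    have hmem : normalize y ∈ sphere (0 : E) 1 := by
      simp [norm_normalize_eq_one_iff.2 hy0]
    have h' := h (update ξ k ⟨normalize y, hmem⟩)
    rw [sphereConfig_update] at h'
    exact h'
  rw [hev.fderiv_eq, fderiv_add_const]

omit [Fintype Λ] [FiniteDimensional ℝ E] [DecidableEq Λ] in
/-- Constancy of the difference in the two-point form used by `luscher_poisson_unique` gives the
one-constant form. -/
theorem forall_eq_add_const_of_sub_eq_sub [Nonempty Λ] [Nontrivial E] {F₁ F₂ : (Λ → E) → ℝ}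
    (h : ∀ ξ ξ' : Λ → sphere (0 : E) 1,
      F₁ (fun n => (ξ n : E)) - F₂ (fun n => (ξ n : E)) =
        F₁ (fun n => (ξ' n : E)) - F₂ (fun n => (ξ' n : E))) :
    ∃ c : ℝ, ∀ ξ : Λ → sphere (0 : E) 1, F₁ (fun n => (ξ n : E)) = F₂ (fun n => (ξ n : E)) + c := by
  haveI : Nonempty (sphere (0 : E) 1) := (NormedSpace.sphere_nonempty.mpr zero_le_one).to_subtype
  obtain ⟨ξ₀⟩ := (inferInstance : Nonempty (Λ → sphere (0 : E) 1))
  exact ⟨F₁ (fun n => (ξ₀ n : E)) - F₂ (fun n => (ξ₀ n : E)), fun ξ => by linarith [h ξ ξ₀]⟩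

/-- **The source of the next order does not see the constant ambiguity**: if `X₁ = X₂ + c` on the
product of unit spheres then `Σ_n ⟪∂̃_n S, ∂̃_n X₁⟫ = Σ_n ⟪∂̃_n S, ∂̃_n X₂⟫` there. -/
theorem sum_inner_siteGrad_congr {S X₁ X₂ : (Λ → E) → ℝ} {c : ℝ}
    (h : ∀ ξ : Λ → sphere (0 : E) 1, X₁ (fun n => (ξ n : E)) = X₂ (fun n => (ξ n : E)) + c)
    (ξ : Λ → sphere (0 : E) 1) :
    ∑ n, ⟪siteGrad n S (fun m => (ξ m : E)), siteGrad n X₁ (fun m => (ξ m : E))⟫ =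
      ∑ n, ⟪siteGrad n S (fun m => (ξ m : E)), siteGrad n X₂ (fun m => (ξ m : E))⟫ :=
  Finset.sum_congr rfl fun n _ => by rw [siteGrad_eq_of_forall_eq_add_const h ξ n]

end OnlySpheres

/-! ## §2 Uniqueness of the series up to constants, order by order -/

section Unique

variable [MeasurableSpace E] [BorelSpace E]

/-- **LÜSCHER'S FLOW-ACTION SERIES IS UNIQUE UP TO ADDITIVE CONSTANTS, ORDER BY ORDER, AND ITS
CONSTANTS `ċ_k` ARE UNIQUELY DETERMINED** (`dim E ≥ 2`, any action `S`): two families of `C²`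
functionals solving `−Σ∂̃²S̃⁽⁰⁾ = S + ċ₀`, `−Σ∂̃²S̃⁽ᵏ⁺¹⁾ = −Σ⟪∂̃S, ∂̃S̃⁽ᵏ⁾⟩ + ċ_{k+1}` on the product of
unit spheres have the same constants and differ, at every order, by a constant there. -/
theorem luscher_series_unique [Nonempty Λ] (h2 : 2 ≤ Module.finrank ℝ E) {S : (Λ → E) → ℝ}
    {St St' : ℕ → (Λ → E) → ℝ} {c c' : ℕ → ℝ}
    (hSt : ∀ k, ContDiff ℝ 2 (St k)) (hSt' : ∀ k, ContDiff ℝ 2 (St' k))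
    (h0 : ∀ ξ : Λ → sphere (0 : E) 1,
      -∑ n, siteLaplacian n (St 0) (fun m => (ξ m : E)) = S (fun m => (ξ m : E)) + c 0)
    (h0' : ∀ ξ : Λ → sphere (0 : E) 1,
      -∑ n, siteLaplacian n (St' 0) (fun m => (ξ m : E)) = S (fun m => (ξ m : E)) + c' 0)
    (hs : ∀ k, ∀ ξ : Λ → sphere (0 : E) 1,
      -∑ n, siteLaplacian n (St (k + 1)) (fun m => (ξ m : E)) =
        -(∑ n, ⟪siteGrad n S (fun m => (ξ m : E)), siteGrad n (St k) (fun m => (ξ m : E))⟫) +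
          c (k + 1))
    (hs' : ∀ k, ∀ ξ : Λ → sphere (0 : E) 1,
      -∑ n, siteLaplacian n (St' (k + 1)) (fun m => (ξ m : E)) =
        -(∑ n, ⟪siteGrad n S (fun m => (ξ m : E)), siteGrad n (St' k) (fun m => (ξ m : E))⟫) +
          c' (k + 1)) :
    ∀ k, c k = c' k ∧ ∃ d : ℝ, ∀ ξ : Λ → sphere (0 : E) 1,
      St k (fun m => (ξ m : E)) = St' k (fun m => (ξ m : E)) + d := by
  haveI : Nontrivial E := Module.nontrivial_of_finrank_pos (R := ℝ) (by omega)
  intro k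
  induction k with
  | zero =>
      obtain ⟨hc, hd⟩ := luscher_poisson_unique h2 (hSt 0) (hSt' 0) h0 h0'
      exact ⟨hc, forall_eq_add_const_of_sub_eq_sub hd⟩
  | succ k ih =>
      obtain ⟨-, d, hd⟩ := ih
      -- the two sources agree on the spheres
      have hs'' : ∀ ξ : Λ → sphere (0 : E) 1,
          -∑ n, siteLaplacian n (St' (k + 1)) (fun m => (ξ m : E)) =
            -(∑ n, ⟪siteGrad n S (fun m => (ξ m : E)), siteGrad n (St k) (fun m => (ξ m : E))⟫) +
              c' (k + 1) := fun ξ => by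
        rw [hs' k ξ, sum_inner_siteGrad_congr hd ξ]
      obtain ⟨hc, hd'⟩ := luscher_poisson_unique h2
        (R := fun x => -(∑ n, ⟪siteGrad n S x, siteGrad n (St k) x⟫)) (hSt (k + 1))
        (hSt' (k + 1)) (hs k) hs''
      exact ⟨hc, forall_eq_add_const_of_sub_eq_sub hd'⟩

/-- **FOR A POLYNOMIAL ACTION EVERY LÜSCHER SERIES IS POLYNOMIAL, ORDER BY ORDER, UP TO CONSTANTS
ON THE SPHERES**: if `S ∈ polyS a` and `(S̃'⁽ᵏ⁾, ċ'_k)` is any `C²` solution of the recursion, then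
at each order `S̃'⁽ᵏ⁾` agrees on the product of unit spheres with a lattice polynomial of degree
`≤ a(k+1)` plus a constant (`exists_luscher_series` + `luscher_series_unique`). -/
theorem luscher_series_polynomial [Nonempty Λ] (h2 : 2 ≤ Module.finrank ℝ E) {a : ℕ}
    {S : (Λ → E) → ℝ} (hS : S ∈ polyS Λ E a) {St' : ℕ → (Λ → E) → ℝ} {c' : ℕ → ℝ}
    (hSt' : ∀ k, ContDiff ℝ 2 (St' k))
    (h0' : ∀ ξ : Λ → sphere (0 : E) 1,
      -∑ n, siteLaplacian n (St' 0) (fun m => (ξ m : E)) = S (fun m => (ξ m : E)) + c' 0)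
    (hs' : ∀ k, ∀ ξ : Λ → sphere (0 : E) 1,
      -∑ n, siteLaplacian n (St' (k + 1)) (fun m => (ξ m : E)) =
        -(∑ n, ⟪siteGrad n S (fun m => (ξ m : E)), siteGrad n (St' k) (fun m => (ξ m : E))⟫) +
          c' (k + 1)) (k : ℕ) :
    ∃ P ∈ polyS Λ E (a * (k + 1)), ∃ d : ℝ, ∀ ξ : Λ → sphere (0 : E) 1,
      St' k (fun m => (ξ m : E)) = P (fun m => (ξ m : E)) + d := by
  obtain ⟨St, c, hmem, h0, hs⟩ := exists_luscher_series h2 hS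
  obtain ⟨-, d, hd⟩ := luscher_series_unique h2 hSt'
    (fun k => contDiff_infty.1 (contDiff_of_mem_polyS (hmem k)) 2) h0' h0 hs' hs k
  exact ⟨St k, hmem k, d, hd⟩

/-- **The Engel–Schaefer case**: every `C²` Lüscher series of the lattice CP(N−1)/O(N) action
`S = −κ Σ_n ⟪x_n, J_n⟫ + S₀` (any couplings) is, at order `k`, a lattice polynomial of degree
`≤ 2(k+1)` plus a constant on the product of unit spheres. -/
theorem luscher_series_esAction_polynomial [Nonempty Λ] (h2 : 2 ≤ Module.finrank ℝ E) (κ S₀ : ℝ)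
    (U : Λ → Λ → (E →L[ℝ] E)) {St' : ℕ → (Λ → E) → ℝ} {c' : ℕ → ℝ}
    (hSt' : ∀ k, ContDiff ℝ 2 (St' k))
    (h0' : ∀ ξ : Λ → sphere (0 : E) 1,
      -∑ n, siteLaplacian n (St' 0) (fun m => (ξ m : E)) =
        esAction κ S₀ U (fun m => (ξ m : E)) + c' 0)
    (hs' : ∀ k, ∀ ξ : Λ → sphere (0 : E) 1,
      -∑ n, siteLaplacian n (St' (k + 1)) (fun m => (ξ m : E)) =
        -(∑ n, ⟪siteGrad n (esAction κ S₀ U) (fun m => (ξ m : E)),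
            siteGrad n (St' k) (fun m => (ξ m : E))⟫) + c' (k + 1)) (k : ℕ) :
    ∃ P ∈ polyS Λ E (2 * (k + 1)), ∃ d : ℝ, ∀ ξ : Λ → sphere (0 : E) 1,
      St' k (fun m => (ξ m : E)) = P (fun m => (ξ m : E)) + d :=
  luscher_series_polynomial h2 (esAction_mem_polyS κ S₀ U) hSt' h0' hs' k

end Unique

end Summit.Ventures.LatticeQCDFlow.Exactness

end
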